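import Summits.NavierStokesRegularity.FluidComputer.CKNFace
import Summits.NavierStokesRegularity.FluidComputer.BandFluxCeiling
import Literature.Analysis.FluidPDE.TsaiLocalEnergyHolds
import HarnessLib

/-!
# Fluid computer — the level dictionary, DISSIPATION-CONCENTRATION FACE (L44): at arbitrarily small scales around
# the focus the normalised local dissipation exceeds an absolute `ε` (CKN's Proposition 2 at the final time)

HONEST FRAMING (cell `pub-fluidc`, verbatim): *low prior, high value-of-information experiment on Tao's
machine paradigm; NOT a claim that NS blows up.* Theorem side of the cell; nothing here is evidence of blow-up.
L34 reads Caffarelli–Kohn–Nirenberg's FIRST `ε`-regularity criterion (`|u|³ + |p|^{3/2}`) at the focus. Their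
SECOND criterion — Proposition 2: `limsup_{r→0} r⁻¹ ∫∫_{Q_r} |∇u|² ≤ ε ⇒ regular` — in Tsai's backward form at the
TOP of the cylinder (Tsai 1998, Lemma 4.2; PROVED in the tree as `tsai1998_lemma42_holds`) is stated in the
currency a DNS monitors: the DISSIPATION `|∇u|²`. Read at the focus `x₀` of a maximal smooth solution `(u, p)` of
the unforced Navier–Stokes system on `ℝ³ × [0, T)` (`ν > 0`), Leray–Hopf from `u 0`, through the
viscosity-normalised solution `w = ν⁻¹u(ν⁻¹·)` on `[0, νT)` (`CKNFace.rescaled_classical_lerayHopf`):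

* `lemma42_hypotheses` — `(w, q)` (`q` the Riesz-gauged rescaled pressure) satisfies the hypotheses of Tsai's
  Lemma 4.2 on every backward cylinder `Q_ρ(νT, x₀)`, `0 < ρ`, `ρ² ≤ νT`, with the CLASSICAL gradient as the weak
  gradient (suitable class restricted from the slab, Leray's energy bound, dissipation through `νT`
  (`IsLerayHopfOn.lintegral_frobeniusNormSq_fderiv_of_classical`), gauged pressure in `L^{3/2}`);
* `dissipation_concentration_at` (**L44 AT A SINGULAR POINT**): with an ABSOLUTE `ε > 0` (Tsai's constant at
  viscosity `1`): at every point `x₀` where `u` is unbounded on every backward parabolic neighbourhood of `(T, x₀)`,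
  `ε < limsup_{r→0⁺} r⁻¹ ∫∫_{Q_r(νT, x₀)} |∇w|²` — in the original variables
  `r⁻¹∫∫_{Q_r(νT,x₀)}|∇w|² = (νr)⁻¹ ∫_{T−r²/ν}^{T} ∫_{B_r(x₀)} |∇u|²`: along a sequence of scales `r ↓ 0` the energy
  dissipated within distance `r` of the focus during the last `r²/ν` before `T` is `> ε ν² r`;
* `dissipation_concentration` (**L44**): the same at the focus of L33′, which exists.

Reading for the machine paradigm (words): the dissipation cannot desert the focus — however small the viscous
parabolic cylinder around it, along a sequence of scales it burns at least an absolute `ε` in scale-invariant units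
`ν²r`; compare L18′ (tail dissipation floor in LEVEL currency, i.o. in the level) and L34 (`ε` of `|u|³ + |p|^{3/2}`
at EVERY scale). `ε` inexplicit; `limsup` in the scale, not every scale. Necessity only. 0 sorry; no new
definitions, no named facts.

## References

* L. Caffarelli, R. Kohn, L. Nirenberg, Comm. Pure Appl. Math. 35 (1982) 771–831, Prop. 2. [CKN1982]
* T.-P. Tsai, Arch. Rational Mech. Anal. 143 (1998) 29–51, Lemma 4.2 (p. 46). [Tsai1998]
* F. Lin, Comm. Pure Appl. Math. 51 (1998) 241–257, Thm. 3.6. [Lin1998]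
-/

noncomputable section

open MeasureTheory Set Function Filter Topology TopologicalSpace Metric
open scoped ENNReal NNReal
open Literature.Analysis.FluidPDE Literature.Analysis.FunctionSpaces
open Summit.NavierStokesRegularity.FluidComputer.LocalisationFace
open Summit.NavierStokesRegularity.FluidComputer.CKNFace

namespace Summit.NavierStokesRegularity.FluidComputer.DissipationConcentrationFace

/-- **Tsai's Lemma 4.2 hypotheses on backward cylinders whose top is the lifespan, unit viscosity.** For a
classical solution `(w, π)` on `ℝ³ × [0, T')` with viscosity `1`, Leray–Hopf from `w 0`, and `0 < ρ`, `ρ² ≤ T'`: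
on `Q_ρ(T', x₀)` the pair `(w, q)` with the Riesz-gauged pressure `q = π − (π(·,0) − p̃[w](0))` is a suitable weak
solution (restriction from the slab, `SereginSverak2002.isSuitableWeakSolutionOn_gauge_of_classical`), `w` has the
energy bound `∫_{B_ρ}|w(t)|² ≤ ‖w(0)‖₂²`, the classical gradient is a weak gradient square integrable on the
cylinder (dissipation through `T'`), and `q ∈ L^{3/2}(Q_ρ)`. [cite: Tsai1998, Lemma 4.2 (p. 46)]
[cite: CKN1982, (2.1)–(2.5)] -/
theorem lemma42_hypotheses {T' : ℝ} (hT' : 0 < T')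
    {w : ℝ → EuclideanSpace ℝ (Fin 3) → EuclideanSpace ℝ (Fin 3)} {π : ℝ → EuclideanSpace ℝ (Fin 3) → ℝ}
    (hcl : IsClassicalNSSolutionOn (Ico 0 T') 1 0 w π) (hLH : IsLerayHopfOn T' 1 0 (w 0) w)
    (x₀ : EuclideanSpace ℝ (Fin 3)) {ρ : ℝ} (hρ : 0 < ρ) (hρT : ρ ^ 2 ≤ T') :
    IsSuitableWeakSolutionOn (parabolicCylinderOpens ρ ((T' : ℝ), x₀)) 1 0 w
        (fun t x => π t x - (π t 0 - normalisedPressure (w t) 0)) ∧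
      (∃ C : ℝ≥0, ∀ᵐ t : ℝ, t ∈ Ioo (T' - ρ ^ 2) T' →
        ∫⁻ x in ball x₀ ρ, ‖w t x‖ₑ ^ 2 ≤ C) ∧
      HasWeakSpatialGradientOn (parabolicCylinderOpens ρ ((T' : ℝ), x₀)) w (fun t x => fderiv ℝ (w t) x) ∧
      (∫⁻ z in parabolicCylinder ρ ((T' : ℝ), x₀),
          ENNReal.ofReal (frobeniusNormSq (fderiv ℝ (w z.1) z.2)) < ∞) ∧
      ∫⁻ z in parabolicCylinder ρ ((T' : ℝ), x₀),
          ‖(fun t x => π t x - (π t 0 - normalisedPressure (w t) 0)) z.1 z.2‖ₑ ^ (3 / 2 : ℝ) < ∞ := by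
  have _ := hρ
  set qg : ℝ → EuclideanSpace ℝ (Fin 3) → ℝ := fun t x => π t x - (π t 0 - normalisedPressure (w t) 0)
    with hqg
  set Q : Opens (ℝ × EuclideanSpace ℝ (Fin 3)) :=
    ⟨Ioo 0 T' ×ˢ univ, isOpen_Ioo.prod isOpen_univ⟩ with hQdef
  have hQ : (Q : Set (ℝ × EuclideanSpace ℝ (Fin 3))) ⊆ Ioo 0 T' ×ˢ univ := Subset.rfl
  have hsw : IsSuitableWeakSolutionOn Q 1 0 w qg :=
    SereginSverak2002.isSuitableWeakSolutionOn_gauge_of_classical one_pos hT' hcl hLH Q hQ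
  have hIsub : Ioo (T' - ρ ^ 2) T' ⊆ Ioo 0 T' := Ioo_subset_Ioo (by linarith) le_rfl
  have hcyl : parabolicCylinder ρ ((T' : ℝ), x₀) ⊆ (Q : Set (ℝ × EuclideanSpace ℝ (Fin 3))) := by
    intro z hz
    rw [mem_parabolicCylinder] at hz
    exact ⟨hIsub hz.1, mem_univ _⟩
  have hcyl' : parabolicCylinder ρ ((T' : ℝ), x₀) ⊆ Ioo 0 T' ×ˢ (univ : Set (EuclideanSpace ℝ (Fin 3))) := hcyl
  have hle : parabolicCylinderOpens ρ ((T' : ℝ), x₀) ≤ Q := fun z hz => hcyl hz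
  have hw0 : MemLp (w 0) 2 volume := hLH.memLp 0 ⟨le_rfl, hT'.le⟩
  refine ⟨hsw.of_le hle, ?_, ?_, ?_, ?_⟩
  · -- energy bound from Leray's energy inequality
    refine ⟨((eLpNorm (w 0) 2 volume) ^ 2).toNNReal, ae_of_all _ fun t ht => ?_⟩
    rw [ENNReal.coe_toNNReal (ENNReal.pow_ne_top hw0.eLpNorm_ne_top)]
    have htI : t ∈ Icc 0 T' := ⟨(hIsub ht).1.le, ht.2.le⟩
    have h2 := eLpNorm_natCast_pow_eq_lintegral volume (w t) (n := 2) (by norm_num)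
    simp only [Nat.cast_ofNat] at h2
    calc ∫⁻ x in ball x₀ ρ, ‖w t x‖ₑ ^ 2 ≤ ∫⁻ x, ‖w t x‖ₑ ^ 2 := setLIntegral_le_lintegral _ _
      _ = eLpNorm (w t) 2 volume ^ 2 := h2.symm
      _ ≤ eLpNorm (w 0) 2 volume ^ 2 := pow_le_pow_left' (hLH.eLpNorm_le_eLpNorm_datum zero_le_one hw0 htI) 2
  · -- the classical gradient is a weak gradient on the cylinder
    have hsm : IsSmoothSpaceTimeOn (Ioo 0 T') w := hcl.smooth_velocity.mono Ioo_subset_Ico_self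
    have hG : HasWeakSpatialGradientOn Q w fun t x => fderiv ℝ (w t) x :=
      hasWeakSpatialGradientOn_of_contDiffOn isOpen_Ioo hQ (hsm.of_le (by exact_mod_cast le_top))
    exact hG.mono hle
  · -- dissipation through `T'`
    have hdis := (IsLerayHopfOn.lintegral_frobeniusNormSq_fderiv_of_classical hcl hLH hT').1
    exact ((lintegral_mono_set hcyl').trans
      (SereginSverak2002.lintegral_slab_le_lintegral_lintegral _ _)).trans_lt hdis.lt_top
  · -- the gauged pressure in `L^{3/2}`
    exact (lintegral_mono_set hcyl').trans_lt
      (SereginSverak2002.lintegral_slab_gauged_pressure_lt_top one_pos hT' hcl hLH)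

/-- **L44 AT A SINGULAR POINT — THE DISSIPATION CONCENTRATES AT THE FOCUS.** There is an absolute `ε > 0` such
that for every `ν > 0`, `T > 0`, every classical solution `(u, p)` of the unforced Navier–Stokes system on
`ℝ³ × [0, T)` which is Leray–Hopf from `u 0`, and every point `x₀` at which `u` is unbounded on every backward
parabolic neighbourhood of `(T, x₀)`: for the viscosity-normalised solution `w = ν⁻¹u(ν⁻¹·)` (lifespan `νT`),
`ε < limsup_{r→0⁺} r⁻¹ ∫∫_{Q_r(νT, x₀)} |∇w|²`. Otherwise Tsai's Lemma 4.2 (PROVED in the tree) bounds `w`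
essentially on some `Q_{r₁}(νT, x₀)`, hence pointwise by continuity, hence `u` on `(T − r², T) × B_r(x₀)` for
`r = r₁/(1 + √ν)` — contradicting the singularity. [cite: Tsai1998, Lemma 4.2 (p. 46)] [cite: CKN1982, Prop. 2] -/
theorem dissipation_concentration_at :
    ∃ ε : ℝ, 0 < ε ∧ ∀ (ν T : ℝ), 0 < ν → 0 < T →
      ∀ (u : ℝ → EuclideanSpace ℝ (Fin 3) → EuclideanSpace ℝ (Fin 3)) (p : ℝ → EuclideanSpace ℝ (Fin 3) → ℝ),
      IsClassicalNSSolutionOn (Ico 0 T) ν 0 u p → IsLerayHopfOn T ν 0 (u 0) u →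
      ∀ x₀ : EuclideanSpace ℝ (Fin 3),
        (∀ r : ℝ, 0 < r → ∀ M : ℝ, ∃ t ∈ Ioo (T - r ^ 2) T, 0 < t ∧ ∃ x ∈ ball x₀ r, M < ‖u t x‖) →
        ENNReal.ofReal ε <
          limsup (fun r : ℝ => (ENNReal.ofReal r)⁻¹ *
            ∫⁻ z in parabolicCylinder r ((T * ν : ℝ), x₀),
              ENNReal.ofReal (frobeniusNormSq (fderiv ℝ (timeRescale ν⁻¹ ν⁻¹ u z.1) z.2)))
            (𝓝[>] (0 : ℝ)) := by
  obtain ⟨ε, hε, H⟩ := tsai1998_lemma42_holds 1 one_pos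
  refine ⟨ε, hε, fun ν T hν hT u p hcl hLH x₀ hsing => ?_⟩
  by_contra hle
  rw [not_lt] at hle
  -- the viscosity-normalised solution on `[0, νT)` and Tsai's hypotheses on `Q_ρ(νT, x₀)`, `ρ = √(νT)`
  set w : ℝ → EuclideanSpace ℝ (Fin 3) → EuclideanSpace ℝ (Fin 3) := timeRescale ν⁻¹ ν⁻¹ u with hwdef
  set π : ℝ → EuclideanSpace ℝ (Fin 3) → ℝ := timeRescale ν⁻¹ (ν⁻¹ ^ 2) p with hπdef
  have hTν : 0 < T * ν := mul_pos hT hν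
  obtain ⟨hclw, hLHw⟩ := rescaled_classical_lerayHopf hν hT hcl hLH
  set ρ : ℝ := Real.sqrt (T * ν) with hρdef
  have hρ : 0 < ρ := Real.sqrt_pos.2 hTν
  have hρT : ρ ^ 2 ≤ T * ν := (Real.sq_sqrt hTν.le).le
  obtain ⟨hsuit, henergy, hG, hG2, hq⟩ := lemma42_hypotheses hTν hclw hLHw x₀ hρ hρT
  have hz1 : ((T * ν : ℝ), x₀).1 ∈ Ioc (T * ν - ρ ^ 2) (T * ν) := ⟨by simp only; nlinarith, le_rfl⟩
  have hz2 : ((T * ν : ℝ), x₀).2 ∈ ball x₀ ρ := mem_ball_self hρ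
  obtain ⟨r₁, hr₁, hreg⟩ := H ρ (T * ν) x₀ w _ _ hρ hsuit henergy hG hG2 hq ((T * ν : ℝ), x₀) hz1 hz2 hle
  -- `w` is bounded pointwise on `Q_{r₁}(νT, x₀)` by continuity
  set V : Set (ℝ × EuclideanSpace ℝ (Fin 3)) := parabolicCylinder r₁ ((T * ν : ℝ), x₀) with hV
  set N : ℝ := (eLpNorm (uncurry w) ∞ (volume.restrict V)).toReal with hN
  have hNtop : eLpNorm (uncurry w) ∞ (volume.restrict V) ≠ ⊤ := hreg.ne
  have hae : ∀ᵐ z ∂(volume.restrict V), ‖uncurry w z‖ ≤ N := by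
    filter_upwards [ae_le_eLpNormEssSup (f := uncurry w) (μ := volume.restrict V)] with z hz
    rw [← eLpNorm_exponent_top] at hz
    rw [← ofReal_norm] at hz
    exact (ENNReal.ofReal_le_iff_le_toReal hNtop).1 hz
  have hVo : IsOpen V := isOpen_parabolicCylinder _ _
  -- work on the part of `V` above `t = 0` (the cylinder may poke below `0` if `r₁² > νT`)
  set V' : Set (ℝ × EuclideanSpace ℝ (Fin 3)) := V ∩ (Ioi (0 : ℝ) ×ˢ (univ : Set (EuclideanSpace ℝ (Fin 3))))
    with hV'
  have hV'o : IsOpen V' := hVo.inter (isOpen_Ioi.prod isOpen_univ)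
  have hae' : ∀ᵐ z ∂(volume.restrict V'), ‖uncurry w z‖ ≤ N :=
    ae_restrict_of_ae_restrict_of_subset inter_subset_left hae
  have hV'sub : ∀ z ∈ V', ν⁻¹ * z.1 ∈ Ico 0 T := by
    rintro z ⟨hz, hz0, -⟩
    rw [hV, mem_parabolicCylinder] at hz
    have h2 : z.1 < T * ν := hz.1.2
    have hz1 : 0 < z.1 := mem_Ioi.1 hz0
    refine ⟨(mul_pos (inv_pos.2 hν) hz1).le, ?_⟩
    calc ν⁻¹ * z.1 < ν⁻¹ * (T * ν) := mul_lt_mul_of_pos_left h2 (inv_pos.2 hν)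
      _ = T := by field_simp
  have hcont : ContinuousOn (uncurry w) V' := by
    have hu := SereginSverak2002.continuousOn_uncurry hcl
    have hφ : Continuous (fun z : ℝ × EuclideanSpace ℝ (Fin 3) => (ν⁻¹ * z.1, z.2)) :=
      (continuous_const.mul continuous_fst).prodMk continuous_snd
    have hmaps : MapsTo (fun z : ℝ × EuclideanSpace ℝ (Fin 3) => (ν⁻¹ * z.1, z.2)) V'
        (Ico 0 T ×ˢ (univ : Set (EuclideanSpace ℝ (Fin 3)))) := fun z hz => ⟨hV'sub z hz, mem_univ _⟩
    have hcomp := (hu.comp hφ.continuousOn hmaps).const_smul ν⁻¹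
    refine hcomp.congr fun z _ => ?_
    simp only [hwdef, uncurry, timeRescale, Pi.smul_apply, Function.comp_apply]
  have hpt : ∀ z ∈ V', ‖uncurry w z‖ ≤ N :=
    SereginSverak2002.norm_le_of_ae_restrict_of_continuousOn hV'o hcont hae'
  -- the singular point of `u`: radius `r = r₁/(1 + √ν)`, threshold `ν N`
  set r : ℝ := r₁ / (1 + Real.sqrt ν) with hr
  have hsq : 0 ≤ Real.sqrt ν := Real.sqrt_nonneg ν
  have hr0 : 0 < r := by rw [hr]; positivity
  have hrdef : r * (1 + Real.sqrt ν) = r₁ := by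
    rw [hr]
    field_simp
  have hrρ : r ≤ r₁ := by nlinarith [hrdef, mul_nonneg hr0.le hsq]
  have hνr : ν * r ^ 2 ≤ r₁ ^ 2 := by
    have h1 : Real.sqrt ν * r ≤ r₁ := by nlinarith [hrdef, hr0.le, hsq]
    have h2 : 0 ≤ Real.sqrt ν * r := mul_nonneg hsq hr0.le
    calc ν * r ^ 2 = (Real.sqrt ν * r) ^ 2 := by rw [mul_pow, Real.sq_sqrt hν.le]
      _ ≤ r₁ ^ 2 := pow_le_pow_left₀ h2 h1 2
  obtain ⟨t, ht, ht0, x, hx, hbig⟩ := hsing r hr0 (ν * N)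
  have hmem : ((ν * t, x) : ℝ × EuclideanSpace ℝ (Fin 3)) ∈ V' := by
    refine ⟨?_, mem_Ioi.2 (mul_pos hν ht0), mem_univ _⟩
    rw [hV, mem_parabolicCylinder]
    refine ⟨⟨?_, ?_⟩, ?_⟩
    · show T * ν - r₁ ^ 2 < ν * t
      have h1 : T - t < r ^ 2 := by linarith [ht.1]
      nlinarith [mul_lt_mul_of_pos_left h1 hν]
    · show ν * t < T * ν
      nlinarith [ht.2]
    · show dist x x₀ < r₁
      exact (mem_ball.1 hx).trans_le hrρ
  have hle' := hpt _ hmem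
  have hval : uncurry w (ν * t, x) = ν⁻¹ • u t x := by
    simp only [hwdef, uncurry, timeRescale]
    rw [← mul_assoc, inv_mul_cancel₀ hν.ne', one_mul]
  rw [hval, norm_smul, norm_inv, Real.norm_of_nonneg hν.le] at hle'
  have : ‖u t x‖ ≤ ν * N := by
    rw [inv_mul_le_iff₀ hν] at hle'
    exact hle'
  linarith

/-- **L44 — DISSIPATION CONCENTRATION AT THE FOCUS.** With the absolute `ε` of `dissipation_concentration_at`:
every maximal smooth solution `(u, p)` of the unforced Navier–Stokes system on `ℝ³ × [0, T)` (`ν > 0`, `T > 0`)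
which is Leray–Hopf from `u 0` has a point `x₀` (the singular point of L33′) with
`ε < limsup_{r→0⁺} r⁻¹ ∫∫_{Q_r(νT, x₀)} |∇w|²`, `w = ν⁻¹u(ν⁻¹·)`. [cite: Tsai1998, Lemma 4.2 (p. 46)]
[cite: CKN1982, Prop. 2] -/
theorem dissipation_concentration :
    ∃ ε : ℝ, 0 < ε ∧ ∀ (ν T : ℝ), 0 < ν → 0 < T →
      ∀ (u : ℝ → EuclideanSpace ℝ (Fin 3) → EuclideanSpace ℝ (Fin 3)) (p : ℝ → EuclideanSpace ℝ (Fin 3) → ℝ),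
      IsMaximalSmoothSolution ν 0 u p T → IsLerayHopfOn T ν 0 (u 0) u →
      ∃ x₀ : EuclideanSpace ℝ (Fin 3),
        (∀ r : ℝ, 0 < r → ∀ M : ℝ, ∃ t ∈ Ioo (T - r ^ 2) T, 0 < t ∧ ∃ x ∈ ball x₀ r, M < ‖u t x‖) ∧
        ENNReal.ofReal ε <
          limsup (fun r : ℝ => (ENNReal.ofReal r)⁻¹ *
            ∫⁻ z in parabolicCylinder r ((T * ν : ℝ), x₀),
              ENNReal.ofReal (frobeniusNormSq (fderiv ℝ (timeRescale ν⁻¹ ν⁻¹ u z.1) z.2)))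
            (𝓝[>] (0 : ℝ)) := by
  obtain ⟨ε, hε, H⟩ := dissipation_concentration_at
  refine ⟨ε, hε, fun ν T hν hT u p hmax hLH => ?_⟩
  obtain ⟨x₀, hsing⟩ := exists_singularPoint hν hT hmax hLH
  exact ⟨x₀, hsing, H ν T hν hT u p hmax.1 hLH x₀ hsing⟩

end Summit.NavierStokesRegularity.FluidComputer.DissipationConcentrationFace

end
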